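import Literature.Computability.AlgebraicComplexity.MS21DenseOrbitsHittingSets
import HarnessLib

/-!
# Medini–Shpilka 2021, Thm 48 as typed («Furthermore» clause): independent maps annihilate all
# `(t+1) × (t+1)` minors — proof

Discharge of the named fact `MS2021_thm_48` of
`Literature/Computability/AlgebraicComplexity/MS21DenseOrbitsHittingSets.lean` (cell `val-lit`, row
X6-MS21): `theorem MS2021_thm_48_holds : MS2021_thm_48`.

**ELEMENTARY AS TYPED** (val-lit lead-np RULING (40), 2026-08-26; referee ref-3 advisory): the typed Prop
is only the «Furthermore» clause of Medini–Shpilka's Thm 48 (CCC 2021, LIPIcs 200:19, p.19:15 =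
arXiv:2102.05632 Thm 1.29) — for every `t ≥ 1` SOME uniform `t`-independent polynomial map `G` into an
`r × r` variable matrix, `r ≥ t + 1`, annihilates the determinant of EVERY `(t+1) × (t+1)` minor. The
SIZE clauses of Thm 48 (the annihilator has a `ΣΠΣ` formula of size `t^{O(√t)}`, resp. `t^t`,
`t^{O(log t)}`), which are the theorem's point ("independent maps are not robust hitting-set
generators"), are NOT typed, and this discharge carries none of that content. No consumer may cite
`MS2021_thm_48` as the content of MS Thm 48.

**Proof** (the rank-`t` witness of RULING (40); it is the map of Forbes–Saptharishi–Tzameret–Wigderson,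
Construction 6.3, specialised): take `r := t + 1`, `c := r + r` (block variables `y_0..y_{r-1}`,
`y'_0..y'_{r-1}`), the arrangement `e := finProdFinEquiv`, and
`G_{(i,j)} := ∑_{l < t} z_l · y_i^{(l)} · y'_j^{(l)}`.
* Each block `(i,j) ↦ z · y_i · y'_j` is `1`-independent: the assignment `y_i = y'_j = 1`, all other
  block variables `0`, maps coordinate `(i,j)` to `z` and every other coordinate to `0`
  (`MS2021.Thm48.isOneIndependent_block`); `G` is the sum of the `t` relabelled blocks, hence
  `t`-independent, and uniform of degree `3`.
* Under `bind₁ G` the `(t+1) × (t+1)` minor `(x_{e(ρ a, κ b)})_{a,b}` becomes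
  `(∑_{l<t} u_{a,l} v_{l,b})_{a,b}` with `u_{a,l} = z_l y^{(l)}_{ρ a}`, `v_{l,b} = y'^{(l)}_{κ b}` — a
  product of a `(t+1) × t` and a `t × (t+1)` matrix, whose determinant vanishes over any commutative
  ring (`MS2021.Thm48.det_sum_mul_eq_zero`: pad both factors to square matrices of size `t + 1` by a
  zero column / zero row and use `det (A ⬝ B) = det A · det B` with `det B = 0`).

Theorem-only file: no definition, no new named fact (D-0026); `VP ≠ VNP` is NOT proved and nothing
here bears on it beyond discharging a typed literature statement by name.

## References
* [MediniShpilka2021] D. Medini, A. Shpilka, *Hitting sets and reconstruction for dense orbits in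
  `VP_e` and `ΣΠΣ` circuits*, CCC 2021, LIPIcs 200:19, Thm 48 (= arXiv:2102.05632 Thm 1.29,
  p0009:L28-L29).
* [ForbesSaptharishiTzameretWigderson2021] M. Forbes, A. Shpilka, I. Tzameret, A. Wigderson,
  *Proof complexity lower bounds from algebraic circuit complexity*, Theory Comput. 17 (2021),
  Construction 6.3 (the rank-`t` map; cited by Medini–Shpilka for Thm 48).
-/

noncomputable section

open MvPolynomial Matrix

namespace Literature.Computability.AlgebraicComplexity

namespace MS2021

namespace Thm48

/-! ### The determinant of a product of a `(t+1) × t` and a `t × (t+1)` matrix vanishes -/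

/-- Over any commutative ring, `det (∑_{l < t} u_{a,l} v_{l,b})_{a,b < t+1} = 0`: the matrix is the
product of the square matrices obtained by padding `u` with a zero last column and `v` with a zero
last row, and the second factor has a zero row. [cite: MediniShpilka2021, Thm 48 (proof idea: rank ≤ t)] -/
theorem det_sum_mul_eq_zero {R : Type*} [CommRing R] (t : ℕ) (u : Fin (t + 1) → Fin t → R)
    (v : Fin t → Fin (t + 1) → R) :
    (Matrix.of fun a b : Fin (t + 1) => ∑ l : Fin t, u a l * v l b).det = 0 := by
  set A : Matrix (Fin (t + 1)) (Fin (t + 1)) R :=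
    Matrix.of fun a l' => Fin.snoc (α := fun _ => R) (u a) 0 l' with hA
  set B : Matrix (Fin (t + 1)) (Fin (t + 1)) R :=
    Matrix.of fun l' b => Fin.snoc (α := fun _ => R) (fun l => v l b) 0 l' with hB
  have hAB : (Matrix.of fun a b : Fin (t + 1) => ∑ l : Fin t, u a l * v l b) = A * B := by
    ext a b
    rw [Matrix.mul_apply, Fin.sum_univ_castSucc]
    simp [hA, hB, Fin.snoc_castSucc, Fin.snoc_last]
  have hBdet : B.det = 0 :=
    Matrix.det_eq_zero_of_row_eq_zero (Fin.last t) fun b => by simp [hB, Fin.snoc_last]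
  rw [hAB, Matrix.det_mul, hBdet, mul_zero]

/-! ### The block map `(i,j) ↦ z · y_i · y'_j` is `1`-independent -/

/-- The block map `(i,j) ↦ z · y_i · y'_j` on the `r × r` coordinates (`e = finProdFinEquiv`; block
variables `y_i = finSumFinEquiv (inl i)`, `y'_j = finSumFinEquiv (inr j)`) is `1`-independent: the
indicator assignment of `{y_i, y'_j}` isolates coordinate `(i,j)`.
[cite: MediniShpilka2021, Def 19 and Thm 48] -/
theorem isOneIndependent_block (K : Type*) [CommSemiring K] (r : ℕ) :
    IsOneIndependent (K := K) (n := r * r) (t := r + r) (fun m =>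
      X (Sum.inr ()) * X (Sum.inl (finSumFinEquiv (Sum.inl (finProdFinEquiv.symm m).1))) *
        X (Sum.inl (finSumFinEquiv (Sum.inr (finProdFinEquiv.symm m).2)))) := by
  classical
  intro i
  -- the indicator assignment of the row variable `y_{i₁}` and the column variable `y'_{i₂}`
  refine ⟨fun s => Sum.elim (fun i' => if i' = (finProdFinEquiv.symm i).1 then 1 else 0)
      (fun j' => if j' = (finProdFinEquiv.symm i).2 then 1 else 0) (finSumFinEquiv.symm s),
    fun j => ?_⟩
  simp only [map_mul, aeval_X, Sum.elim_inr, Sum.elim_inl, Equiv.symm_apply_apply]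
  by_cases hj : j = i
  · subst hj
    simp
  · have hne : (finProdFinEquiv.symm j).1 ≠ (finProdFinEquiv.symm i).1 ∨
        (finProdFinEquiv.symm j).2 ≠ (finProdFinEquiv.symm i).2 := by
      by_contra hcon
      push Not at hcon
      exact hj (finProdFinEquiv.symm.injective (Prod.ext hcon.1 hcon.2))
    rw [if_neg hj]
    rcases hne with h1 | h2
    · rw [if_neg h1, map_zero, mul_zero, zero_mul]
    · rw [if_neg h2, map_zero, mul_zero]

end Thm48

end MS2021

/-! ### The discharge -/

section Discharge

open MS2021

/-- **MS Thm 48 AS TYPED («Furthermore» clause only), discharged.** For every field of characteristic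
zero (the hypothesis is not used) and every `t ≥ 1` there are `r = t + 1`, `c = 2r`, the arrangement
`finProdFinEquiv` and the uniform `t`-independent map `G_{(i,j)} = ∑_{l<t} z_l y_i^{(l)} y'_j^{(l)}`
(Forbes–Saptharishi–Tzameret–Wigderson, Construction 6.3) annihilating the determinant of every
`(t+1) × (t+1)` minor (the image has rank `≤ t`). ELEMENTARY AS TYPED (val-lit RULING (40)): Thm 48's
size clauses (`ΣΠΣ` formula `t^{O(√t)}` / `t^t` / `t^{O(log t)}`) are untyped and NOT discharged here.
[cite: MediniShpilka2021, Thm 48 (CCC 2021 LIPIcs 200:19, p.19:15; = arXiv:2102.05632 Thm 1.29, p0009:L28-L29)] -/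
theorem MS2021_thm_48_holds : MS2021_thm_48 := by
  classical
  intro K _ _ t _ht
  refine ⟨t + 1, (t + 1) + (t + 1), finProdFinEquiv,
    fun m => ∑ l : Fin t, rename (Prod.mk l)
      (X (Sum.inr ()) * X (Sum.inl (finSumFinEquiv (Sum.inl (finProdFinEquiv.symm m).1))) *
        X (Sum.inl (finSumFinEquiv (Sum.inr (finProdFinEquiv.symm m).2))) :
          MvPolynomial (Fin ((t + 1) + (t + 1)) ⊕ Unit) K),
    le_rfl, ?_, ?_, ?_⟩
  · -- `t`-independent: the sum of `t` relabelled copies of the `1`-independent block map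
    exact ⟨fun _ m => X (Sum.inr ()) *
        X (Sum.inl (finSumFinEquiv (Sum.inl (finProdFinEquiv.symm m).1))) *
        X (Sum.inl (finSumFinEquiv (Sum.inr (finProdFinEquiv.symm m).2))),
      fun _ => Thm48.isOneIndependent_block K (t + 1), fun _ => rfl⟩
  · -- uniform of degree `3`
    refine ⟨1 + 1 + 1, fun m => ?_⟩
    refine IsHomogeneous.sum _ _ _ fun l _ => ?_
    rw [map_mul, map_mul, rename_X, rename_X, rename_X]
    exact ((isHomogeneous_X K _).mul (isHomogeneous_X K _)).mul (isHomogeneous_X K _)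
  · -- every `(t+1) × (t+1)` minor of the variable matrix is annihilated
    intro rows cols
    rw [AlgHom.map_det]
    have hmat : (bind₁ (fun m : Fin ((t + 1) * (t + 1)) => ∑ l : Fin t, rename (Prod.mk l)
        (X (Sum.inr ()) * X (Sum.inl (finSumFinEquiv (Sum.inl (finProdFinEquiv.symm m).1))) *
          X (Sum.inl (finSumFinEquiv (Sum.inr (finProdFinEquiv.symm m).2))) :
            MvPolynomial (Fin ((t + 1) + (t + 1)) ⊕ Unit) K))).mapMatrix
        (Matrix.of fun i j : Fin (t + 1) =>
          (X (finProdFinEquiv (rows i, cols j)) : MvPolynomial (Fin ((t + 1) * (t + 1))) K)) =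
      Matrix.of fun a b : Fin (t + 1) => ∑ l : Fin t,
        ((X (l, Sum.inr ()) : MvPolynomial (Fin t × (Fin ((t + 1) + (t + 1)) ⊕ Unit)) K) *
          X (l, Sum.inl (finSumFinEquiv (Sum.inl (rows a))))) *
          X (l, Sum.inl (finSumFinEquiv (Sum.inr (cols b)))) := by
      ext a b
      simp only [AlgHom.mapMatrix_apply, Matrix.map_apply, Matrix.of_apply, bind₁_X_right,
        Equiv.symm_apply_apply, map_mul, rename_X]
    rw [hmat]
    exact Thm48.det_sum_mul_eq_zero t _ _

end Discharge

end Literature.Computability.AlgebraicComplexity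

end
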